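import Mathlib
import Literature.MathematicalPhysics.QuantumLattice.HubbardBandSectorCountingToolbox
import Summits.HubbardSuperconductivity.HubbardSuperconductivity.Theorems.KLProgrammeKLRegimeTwoPointLimitShellCountTools
import HarnessLib

/-!
# Route `KLProgramme` — crux K3 `KLRegimeTwoPointLimit` (stmt-HubbardSuperconductivity-19937), support:
# grid angles near a point of the band Fermi curve (the class-size half of the refined four-sector count;
# DECOMP §2 C1 «Inputs», U5-NOTE §1(b))

Cell `gate-hubbard-kl`, seat p1b. On the angular grid `θ_a = w/2 + a w` (`a < N`, `N w = 2π`) of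
BGM 2006 App. A2 / the tree's `count_pairs_exists`:

* `klgc_card_le_of_grid_subset_Icc` — grid angles lying in an interval `[x, y]` number `≤ (y - x)/w + 1`
  (they are `w`-separated: `klsk_finite_ncard_le_of_separated`);
* `klgc_card_grid_near_point_le` — the grid angles whose curve point `p_μ(θ_a)` lies within sup-distance
  `R` of a given point number `≤ 4√2π R/(u_min w) + 3` (for `√2 R ≤ u_min`): two such angles have chord
  `≤ 2√2 R`, hence `|sin(Δθ/2)| ≤ √2R/u_min` (`chord_lower`), so `Δθ` lies within `π√2R/u_min` of `0` or
  of `±2π` (Jordan's inequality `Real.mul_abs_le_abs_sin`); the `+3` is the wrap-around of the period.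
This is the number of members of a Cooper transfer class `{a : |p_μ(θ₁) + p_μ(θ_a) - 2πm|_∞ ≤ R}`
(`≍ R/w`), used with the Cooper-keyed fibre count of `…ShellSectorFibreCount` in `…ShellSectorClassCount`.
-/

noncomputable section

-- the tree's namespace `Summit.<Summit>.<Problem>.Theorems` repeats the summit name by design (D-0017)
set_option linter.dupNamespace false

open Real Set MeasureTheory
open Literature.MathematicalPhysics.QuantumLattice
open Literature.MathematicalPhysics.QuantumLattice.BandSectorCounting

namespace Summit.HubbardSuperconductivity.HubbardSuperconductivity.Theorems

/-- `w`-spaced grid angles indexed by a finite set of naturals and lying in an interval `[x, y]`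
number at most `(y - x)/w + 1`. -/
theorem klgc_card_le_of_grid_subset_Icc {w x y : ℝ} (hw : 0 < w) (hxy : x ≤ y) (A : Finset ℕ)
    (hA : ∀ a ∈ A, w / 2 + (a : ℝ) * w ∈ Icc x y) : (A.card : ℝ) ≤ (y - x) / w + 1 := by
  classical
  set f : ℕ → ℝ := fun a => w / 2 + (a : ℝ) * w with hf
  have hfinj : Function.Injective f := by
    intro a a' h
    simp only [hf] at h
    have : (a : ℝ) * w = (a' : ℝ) * w := by linarith
    exact_mod_cast mul_right_cancel₀ hw.ne' this
  set S : Set ℝ := ↑(A.image f) with hS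
  have hSsub : S ⊆ Icc x y := by
    intro z hz
    rw [hS, Finset.coe_image] at hz
    obtain ⟨a, ha, rfl⟩ := hz
    exact hA a ha
  have hsep : ∀ z ∈ S, ∀ z' ∈ S, z < z' → w ≤ z' - z := by
    intro z hz z' hz' hlt
    rw [hS, Finset.coe_image] at hz hz'
    obtain ⟨a, -, rfl⟩ := hz
    obtain ⟨a', -, rfl⟩ := hz'
    simp only [hf] at hlt ⊢
    have h1 : (a : ℝ) * w < (a' : ℝ) * w := by linarith
    have h2 : (a : ℝ) < a' := lt_of_mul_lt_mul_right h1 hw.le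
    have h2' : a < a' := by exact_mod_cast h2
    have h3 : (a : ℝ) + 1 ≤ a' := by exact_mod_cast Nat.succ_le_of_lt h2'
    nlinarith
  have h := (klsk_finite_ncard_le_of_separated hw hxy hSsub hsep).2
  rw [hS, Set.ncard_coe_finset, Finset.card_image_of_injective _ hfinj] at h
  exact h

section Main

variable {a b : ℝ} (B : BandBounds a b) {μ : ℝ} (hμ : μ ∈ Icc a b)
include B hμ

/-- **Grid angles near a point.** The grid angles `θ_a = w/2 + a w`, `a < N` (`N w = 2π`), whose curve
point `p_μ(θ_a)` lies within sup-distance `R` of a point `Q` number at most `4√2π R/(u_min w) + 3`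
(for `√2 R ≤ u_min`): two such angles have chord `≤ 2√2 R`, hence `|sin(Δθ/2)| ≤ √2R/u_min`
(`chord_lower`), so `Δθ` lies within `π√2R/u_min` of `0` or of `±2π` (Jordan). -/
theorem klgc_card_grid_near_point_le {Q₁ Q₂ R w : ℝ} {N : ℕ} (hw : 0 < w) (hN : (N : ℝ) * w = 2 * π)
    (hR : 0 ≤ R) (hRs : Real.sqrt 2 * R ≤ B.umin) :
    ((((Finset.range N).filter fun n : ℕ =>
        max |bandX μ (w / 2 + n * w) - Q₁| |bandY μ (w / 2 + n * w) - Q₂| ≤ R).card : ℝ)) ≤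
      4 * Real.sqrt 2 * π * R / (B.umin * w) + 3 := by
  classical
  have hπ := Real.pi_pos
  have hu := B.umin_pos
  set A := (Finset.range N).filter fun n : ℕ =>
    max |bandX μ (w / 2 + n * w) - Q₁| |bandY μ (w / 2 + n * w) - Q₂| ≤ R with hA
  set σ : ℝ := Real.sqrt 2 * R / B.umin with hσ
  have hσ0 : 0 ≤ σ := by positivity
  have hσ1 : σ ≤ 1 := by rw [hσ, div_le_one hu]; exact hRs
  have hgoal : 4 * Real.sqrt 2 * π * R / (B.umin * w) + 3 = 4 * π * σ / w + 3 := by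
    have hu' := hu.ne'
    have hw' := hw.ne'
    have e : 4 * Real.sqrt 2 * π * R / (B.umin * w) = 4 * π * σ / w := by
      rw [hσ]
      field_simp
    rw [e]
  rw [hgoal]
  rcases A.eq_empty_or_nonempty with hAe | ⟨a₀, ha₀⟩
  · rw [hAe, Finset.card_empty]; push_cast; positivity
  set θ : ℕ → ℝ := fun n => w / 2 + (n : ℝ) * w with hθ
  have hmemA : ∀ n ∈ A, n < N ∧ max |bandX μ (θ n) - Q₁| |bandY μ (θ n) - Q₂| ≤ R := by
    intro n hn
    rw [hA, Finset.mem_filter, Finset.mem_range] at hn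
    exact hn
  obtain ⟨ha₀N, ha₀R⟩ := hmemA a₀ ha₀
  -- the chord bound: `|sin((θ n - θ a₀)/2)| ≤ σ`
  have hsin : ∀ n ∈ A, |Real.sin ((θ n - θ a₀) / 2)| ≤ σ := by
    intro n hn
    obtain ⟨-, hnR⟩ := hmemA n hn
    have hc := chord_lower B hμ (θ n) (θ a₀)
    have hX : |bandX μ (θ n) - bandX μ (θ a₀)| ≤ 2 * R := by
      have h1 : |bandX μ (θ n) - Q₁| ≤ R := (le_max_left _ _).trans hnR
      have h2 : |bandX μ (θ a₀) - Q₁| ≤ R := (le_max_left _ _).trans ha₀R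
      have := abs_sub_le (bandX μ (θ n)) Q₁ (bandX μ (θ a₀))
      rw [abs_sub_comm Q₁] at this
      linarith
    have hY : |bandY μ (θ n) - bandY μ (θ a₀)| ≤ 2 * R := by
      have h1 : |bandY μ (θ n) - Q₂| ≤ R := (le_max_right _ _).trans hnR
      have h2 : |bandY μ (θ a₀) - Q₂| ≤ R := (le_max_right _ _).trans ha₀R
      have := abs_sub_le (bandY μ (θ n)) Q₂ (bandY μ (θ a₀))
      rw [abs_sub_comm Q₂] at this
      linarith
    have hX2 : (bandX μ (θ n) - bandX μ (θ a₀)) ^ 2 ≤ (2 * R) ^ 2 := by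
      rw [← sq_abs]; exact pow_le_pow_left₀ (abs_nonneg _) hX 2
    have hY2 : (bandY μ (θ n) - bandY μ (θ a₀)) ^ 2 ≤ (2 * R) ^ 2 := by
      rw [← sq_abs]; exact pow_le_pow_left₀ (abs_nonneg _) hY 2
    have hs2 : Real.sin ((θ n - θ a₀) / 2) ^ 2 ≤ σ ^ 2 := by
      have e : σ ^ 2 = 2 * R ^ 2 / B.umin ^ 2 := by
        rw [hσ, div_pow, mul_pow, Real.sq_sqrt (by norm_num)]
      rw [e, le_div_iff₀ (by positivity)]
      nlinarith
    have := Real.sqrt_le_sqrt hs2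
    rwa [Real.sqrt_sq_eq_abs, Real.sqrt_sq hσ0] at this
  -- the half-difference `x n = (θ n - θ a₀)/2 = (n - a₀) w/2` lies in `(-π, π)`
  have hx : ∀ n ∈ A, (θ n - θ a₀) / 2 = ((n : ℝ) - a₀) * w / 2 := by
    intro n _; simp only [hθ]; ring
  have hxlt : ∀ n ∈ A, ((n : ℝ) - a₀) * w / 2 < π := by
    intro n hn
    obtain ⟨hnN, -⟩ := hmemA n hn
    have h1 : ((n : ℝ) - a₀) * w ≤ (n : ℝ) * w := by
      have : (0 : ℝ) ≤ (a₀ : ℝ) * w := by positivity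
      nlinarith
    have h2 : (n : ℝ) * w < (N : ℝ) * w := by
      exact mul_lt_mul_of_pos_right (by exact_mod_cast hnN) hw
    linarith
  have hxgt : ∀ n ∈ A, -π < ((n : ℝ) - a₀) * w / 2 := by
    intro n hn
    have h1 : -((a₀ : ℝ) * w) ≤ ((n : ℝ) - a₀) * w := by
      have : (0 : ℝ) ≤ (n : ℝ) * w := by positivity
      nlinarith
    have h2 : (a₀ : ℝ) * w < (N : ℝ) * w := mul_lt_mul_of_pos_right (by exact_mod_cast ha₀N) hw
    linarith
  -- Jordan: `|x| ≤ π/2 ⇒ |x| ≤ πσ/2`; `x > π/2 ⇒ π - x ≤ πσ/2`; `x < -π/2 ⇒ π + x ≤ πσ/2`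
  have jordan : ∀ y : ℝ, |y| ≤ π / 2 → |Real.sin y| ≤ σ → |y| ≤ π * σ / 2 := by
    intro y hy hs
    have h := Real.mul_abs_le_abs_sin hy
    have h2 : 2 / π * |y| ≤ σ := h.trans hs
    rw [div_mul_eq_mul_div, div_le_iff₀ hπ] at h2
    linarith
  -- the three families
  set A₁ := A.filter fun n : ℕ => |((n : ℝ) - a₀) * w / 2| ≤ π / 2 with hA₁
  set A₂ := A.filter fun n : ℕ => π / 2 < ((n : ℝ) - a₀) * w / 2 with hA₂
  set A₃ := A.filter fun n : ℕ => ((n : ℝ) - a₀) * w / 2 < -(π / 2) with hA₃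
  have hcover : A ⊆ A₁ ∪ A₂ ∪ A₃ := by
    intro n hn
    by_cases hc1 : |((n : ℝ) - a₀) * w / 2| ≤ π / 2
    · exact Finset.mem_union_left _ (Finset.mem_union_left _ (Finset.mem_filter.2 ⟨hn, hc1⟩))
    · rcases lt_abs.1 (not_le.1 hc1) with h | h
      · exact Finset.mem_union_left _ (Finset.mem_union_right _ (Finset.mem_filter.2 ⟨hn, h⟩))
      · exact Finset.mem_union_right _ (Finset.mem_filter.2 ⟨hn, by linarith⟩)
  have hcard : (A.card : ℝ) ≤ A₁.card + A₂.card + A₃.card := by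
    have h1 := Finset.card_le_card hcover
    have h2 := Finset.card_union_le (A₁ ∪ A₂) A₃
    have h3 := Finset.card_union_le A₁ A₂
    have : A.card ≤ A₁.card + A₂.card + A₃.card := h1.trans (h2.trans (by omega))
    exact_mod_cast this
  -- family 1: `θ n ∈ [θ a₀ - πσ, θ a₀ + πσ]`
  have h1 : (A₁.card : ℝ) ≤ (θ a₀ + π * σ - (θ a₀ - π * σ)) / w + 1 := by
    apply klgc_card_le_of_grid_subset_Icc hw (by nlinarith [hπ, hσ0]) A₁
    intro n hn
    rw [hA₁, Finset.mem_filter] at hn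
    obtain ⟨hnA, hn1⟩ := hn
    have hs := hsin n hnA
    rw [hx n hnA] at hs
    have hj := jordan _ hn1 hs
    rw [abs_le] at hj
    obtain ⟨hj1, hj2⟩ := hj
    simp only [hθ, mem_Icc]
    constructor <;> linarith
  -- family 2: `x ∈ (π/2, π)`: `sin x = sin (π - x)` and `π - x ∈ [0, π/2)`
  have h2 : (A₂.card : ℝ) ≤ (θ a₀ + 2 * π - (θ a₀ + 2 * π - π * σ)) / w + 1 := by
    apply klgc_card_le_of_grid_subset_Icc hw (by nlinarith [hπ, hσ0]) A₂
    intro n hn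
    rw [hA₂, Finset.mem_filter] at hn
    obtain ⟨hnA, hn2⟩ := hn
    have hs := hsin n hnA
    rw [hx n hnA] at hs
    have hyπ := hxlt n hnA
    have hs' : |Real.sin (π - ((n : ℝ) - a₀) * w / 2)| ≤ σ := by rwa [Real.sin_pi_sub]
    have hj := jordan (π - ((n : ℝ) - a₀) * w / 2) (by rw [abs_le]; constructor <;> linarith) hs'
    rw [abs_le] at hj
    obtain ⟨hj1, hj2⟩ := hj
    simp only [hθ, mem_Icc]
    constructor <;> linarith
  -- family 3: `x ∈ (-π, -π/2)`: `sin x = -sin (π + x)`, `π + x ∈ (0, π/2)`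
  have h3 : (A₃.card : ℝ) ≤ (θ a₀ - 2 * π + π * σ - (θ a₀ - 2 * π)) / w + 1 := by
    apply klgc_card_le_of_grid_subset_Icc hw (by nlinarith [hπ, hσ0]) A₃
    intro n hn
    rw [hA₃, Finset.mem_filter] at hn
    obtain ⟨hnA, hn3⟩ := hn
    have hs := hsin n hnA
    rw [hx n hnA] at hs
    have hyπ := hxgt n hnA
    have hs' : |Real.sin (((n : ℝ) - a₀) * w / 2 + π)| ≤ σ := by rwa [Real.sin_add_pi, abs_neg]
    have hj := jordan (((n : ℝ) - a₀) * w / 2 + π) (by rw [abs_le]; constructor <;> linarith) hs'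
    rw [abs_le] at hj
    obtain ⟨hj1, hj2⟩ := hj
    simp only [hθ, mem_Icc]
    constructor <;> linarith
  have e1 : (θ a₀ + π * σ - (θ a₀ - π * σ)) / w = 2 * π * σ / w := by ring
  have e2 : (θ a₀ + 2 * π - (θ a₀ + 2 * π - π * σ)) / w = π * σ / w := by ring
  have e3 : (θ a₀ - 2 * π + π * σ - (θ a₀ - 2 * π)) / w = π * σ / w := by ring
  rw [e1] at h1; rw [e2] at h2; rw [e3] at h3
  have e4 : 4 * π * σ / w + 3 = (2 * π * σ / w + 1) + (π * σ / w + 1) + (π * σ / w + 1) := by ring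
  rw [e4]
  linarith

end Main

end Summit.HubbardSuperconductivity.HubbardSuperconductivity.Theorems

end
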